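import Mathlib.NumberTheory.NumberField.AdeleRing
import Mathlib.NumberTheory.NumberField.ProductFormula
import Mathlib.NumberTheory.NumberField.Completion.FinitePlace
import Mathlib.NumberTheory.DirichletCharacter.Basic
import Mathlib.Topology.Algebra.RestrictedProduct.Basic
import Mathlib.Topology.Algebra.ContinuousMonoidHom
import Mathlib.Analysis.Meromorphic.Basic
import Literature.NumberTheory.GaloisRepresentations.IntegralGaloisAction
import Literature.NumberTheory.GaloisRepresentations.ArtinLFunction
import HarnessLib

-- D-0014 sorry-sweep (operator, 2026-08-13): sorried theorems -> named facts `def X : Prop`; partial proofs preserved in comments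
-- provenance: harness21/H21/H21/Prelude/GalRep/HeckeCharacter.lean @ 6cce177 (interim HEAD d8f2665); M5 mechanical rewrite
/-!
# Hecke characters (Größencharaktere) and Hecke L-functions

Trunk `GalRep`, item C12 (`hecke_L_function_grossencharacter`).

Let `K` be a number field with adele ring `𝔸_K = NumberField.AdeleRing (𝓞 K) K` (Mathlib).  The
**idele group** is `𝕀_K = 𝔸_Kˣ` with Mathlib's topology on units (`Units.instTopologicalSpace`,
an `IsTopologicalGroup`), and a **Hecke character** (quasi-character of the idele class group,
Größencharakter) is a continuous homomorphism `χ : 𝕀_K → ℂˣ` trivial on the principal ideles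
`Kˣ ↪ 𝕀_K`.

## Main definitions

* `Literature.ideleGroup K`, `Literature.principalIdeles K`, `Literature.HeckeCharacter K` (a structure; `FunLike`,
  `ext`, `CommGroup`), `Literature.NumberTheory.GaloisRepresentations.ideleNorm`.
* Local structure at a finite place `v : HeightOneSpectrum (𝓞 K)`: `Literature.finiteAdeleSingle v`
  (Mathlib `RestrictedProduct.mulSingle` on `FiniteAdeleRing (𝓞 K) K = Πʳ v, [K_v, 𝒪_v]`),
  `Literature.localUnits v : K_vˣ →* 𝕀_K`, `HeckeCharacter.localComponent`, `IsUnramifiedAt`,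
  `valueAtUniformizer`, `ramifiedPlaces`; global predicates `IsUnitary`, `IsFiniteOrder`,
  `IsNormTwist`, `IsAlgebraic` (type `A₀`).  `IsUnramifiedAt` and these four are PREDICATES on `χ`
  (definitions taking `χ` as an explicit binder), not named facts: each holds for some Hecke
  characters and fails for others.
* `Literature.heckeLFunction χ s = ∏'_{v unramified} (1 - χ(ϖ_v) N v^{-s})⁻¹` (a `tprod`, genuine value
  for `re s > 1`), `HeckeCharacter.archGammaFactor`, and the classical theorems as named facts
  (`def X : Prop`, cited): meromorphic continuation, entireness for non-norm-twists, functional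
  equation (Hecke 1918/1920, Tate 1950), and the correspondence with Dirichlet characters for
  `K = ℚ`.  The product formula `ideleNorm_eq_one_of_mem_principalIdeles` is proved from Mathlib
  `NumberField.prod_abs_eq_one`.

Section numbers "Tate (1950), §m.n" refer to the Cassels–Fröhlich printing (Ch. XV): §2 local
theory (§2.3 multiplicative characters, §2.5 computation of `ρ`), §3 abstract restricted direct
product (§3.2 characters, Lemma 3.2.1), §4 the theory in the large (§4.1 additive theory, §4.3
multiplicative theory, §4.4 the zeta-functions and functional equation, Thm. 4.4.1).

## Mathlib search

Mathlib (this pin) has `NumberField.AdeleRing`, `NumberField.InfiniteAdeleRing`,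
`IsDedekindDomain.FiniteAdeleRing` (a `RestrictedProduct`), `RestrictedProduct.mulSingle`,
`NumberField.AdeleRing.principalSubgroup` (the *additive* subgroup `K ⊆ 𝔸_K`; we need the
multiplicative `Kˣ ⊆ 𝕀_K`), `ContinuousMonoidHom` with its `CommGroup` instance,
`HeightOneSpectrum.valuation_exists_uniformizer`, the `NormedField` instance on
`v.adicCompletion K`, `DirichletCharacter`, `MulChar`, `Meromorphic`, `Complex.Gammaℝ/Gammaℂ`;
but no ideles-as-units API, idele norm, Hecke character or Hecke L-function (grep `idele`,
`Hecke`, `Grossen`/`Größen`: nothing relevant).  Continuation predicates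
`Literature.LFunction.HasEntireContinuation/HasMeromorphicContinuation` come from
`Literature.Prelude.GalRep.ArtinLFunction`, `v.residueCard` from `IntegralGaloisAction`.

## References

* E. Hecke, *Eine neue Art von Zetafunktionen und ihre Beziehungen zur Verteilung der
  Primzahlen* I, II, Math. Z. 1 (1918), 6 (1920).
* J. Tate, *Fourier analysis in number fields and Hecke's zeta-functions* (thesis, 1950), in
  Cassels–Fröhlich, *Algebraic Number Theory* (1967), Ch. XV.
* J. Neukirch, *Algebraic Number Theory*, Ch. VI §1 (ideles), Ch. VII §§6–8 (Hecke L-series).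
* A. Weil, *On a certain type of characters of the idèle-class group* (1956) (type `A₀`).
-/

noncomputable section

open NumberField IsDedekindDomain

namespace Literature.NumberTheory.GaloisRepresentations

universe u

variable (K : Type u) [Field K] [NumberField K]

/-! ### Ideles and Hecke characters -/

/-- The **idele group** `𝕀_K = 𝔸_Kˣ` of the number field `K`: the units of Mathlib's adele ring
`NumberField.AdeleRing (𝓞 K) K`, with the units topology (a topological group).
Ref: Neukirch, *Algebraic Number Theory*, Ch. VI §1; Cassels–Fröhlich, Ch. II §16. [folklore] -/
abbrev ideleGroup : Type u := (AdeleRing (𝓞 K) K)ˣ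

/-- The subgroup of **principal ideles**: the image of `Kˣ` under the diagonal embedding
`K → 𝔸_K` (`algebraMap`).  Ref: Neukirch, *Algebraic Number Theory*, Ch. VI §1, Def. (1.2).
[folklore] -/
def principalIdeles : Subgroup (ideleGroup K) :=
  (Units.map (algebraMap K (AdeleRing (𝓞 K) K) : K →* AdeleRing (𝓞 K) K)).range

/-- Evaluation of continuous monoid homs at a point, as a monoid hom (auxiliary). [folklore] -/
def ContinuousMonoidHom.evalAt {A E : Type*} [Monoid A] [TopologicalSpace A] [CommGroup E]
    [TopologicalSpace E] [IsTopologicalGroup E] (a : A) : (A →ₜ* E) →* E where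
  toFun f := f a
  map_one' := rfl
  map_mul' _ _ := rfl

/-- The subgroup of continuous quasi-characters `𝕀_K →ₜ* ℂˣ` trivial on principal ideles
(auxiliary; `HeckeCharacter K` is in bijection with it, `HeckeCharacter.equivSubgroup`).
Ref: Neukirch, *Algebraic Number Theory*, Ch. VII §6, Def. (6.1) (idelic form). [folklore] -/
def heckeCharacterSubgroup : Subgroup (ideleGroup K →ₜ* ℂˣ) :=
  ⨅ x : principalIdeles K, (ContinuousMonoidHom.evalAt (E := ℂˣ) (x : ideleGroup K)).ker

variable {K} in
/-- Membership in `heckeCharacterSubgroup`: triviality on principal ideles. [folklore] -/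
theorem mem_heckeCharacterSubgroup_iff {χ : ideleGroup K →ₜ* ℂˣ} :
    χ ∈ heckeCharacterSubgroup K ↔ ∀ x ∈ principalIdeles K, χ x = 1 := by
  simp only [heckeCharacterSubgroup, Subgroup.mem_iInf, MonoidHom.mem_ker, Subtype.forall]
  rfl

/-- A **Hecke character** (Größencharakter, quasi-character of the idele class group) of the
number field `K`: a continuous homomorphism `χ : 𝕀_K → ℂˣ` with `χ(Kˣ) = 1`.  No unitarity is
imposed (see `HeckeCharacter.IsUnitary`).
Ref: Tate (1950), §4.3 (multiplicative theory) with §2.3 (quasi-characters); Neukirch,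
*Algebraic Number Theory*, Ch. VII §6, Def. (6.1) and Prop. (6.12) (idelic vs ideal-theoretic
Größencharaktere). [cite: TateThesis1967, §4.3] -/
structure HeckeCharacter where
  /-- The underlying continuous homomorphism `𝕀_K →ₜ* ℂˣ`. -/
  toContinuousMonoidHom : ideleGroup K →ₜ* ℂˣ
  /-- Triviality on principal ideles. -/
  map_principal' : ∀ x ∈ principalIdeles K, toContinuousMonoidHom x = 1

namespace HeckeCharacter

variable {K}

/-- `HeckeCharacter K` as functions `𝕀_K → ℂˣ`. [folklore] -/
instance instFunLike : FunLike (HeckeCharacter K) (ideleGroup K) ℂˣ where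
  coe χ := χ.toContinuousMonoidHom
  coe_injective χ ψ h := by
    cases χ; cases ψ; congr; exact DFunLike.coe_injective h

/-- Hecke characters are monoid homomorphisms. [folklore] -/
instance instMonoidHomClass : MonoidHomClass (HeckeCharacter K) (ideleGroup K) ℂˣ where
  map_mul χ := map_mul χ.toContinuousMonoidHom
  map_one χ := map_one χ.toContinuousMonoidHom

/-- Hecke characters are continuous. [folklore] -/
instance instContinuousMapClass : ContinuousMapClass (HeckeCharacter K) (ideleGroup K) ℂˣ where
  map_continuous χ := χ.toContinuousMonoidHom.continuous

/-- Extensionality for Hecke characters. [folklore] -/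
@[ext]
theorem ext {χ ψ : HeckeCharacter K} (h : ∀ x, χ x = ψ x) : χ = ψ :=
  DFunLike.ext _ _ h

/-- The coercion to functions factors through `toContinuousMonoidHom`. [folklore] -/
@[simp]
theorem coe_toContinuousMonoidHom (χ : HeckeCharacter K) :
    (χ.toContinuousMonoidHom : ideleGroup K → ℂˣ) = χ := rfl

/-- A Hecke character is trivial on principal ideles.
Ref: Neukirch, *Algebraic Number Theory*, Ch. VII §6, Def. (6.1). [folklore] -/
theorem map_principal (χ : HeckeCharacter K) {x : ideleGroup K} (hx : x ∈ principalIdeles K) :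
    χ x = 1 :=
  χ.map_principal' x hx

variable (K) in
/-- `HeckeCharacter K` is in bijection with the subgroup `heckeCharacterSubgroup K` of
`𝕀_K →ₜ* ℂˣ`; used to transport the group structure. [folklore] -/
def equivSubgroup : HeckeCharacter K ≃ heckeCharacterSubgroup K where
  toFun χ := ⟨χ.toContinuousMonoidHom, mem_heckeCharacterSubgroup_iff.mpr χ.map_principal'⟩
  invFun f := ⟨f.1, mem_heckeCharacterSubgroup_iff.mp f.2⟩
  left_inv _ := rfl
  right_inv _ := rfl

/-- Hecke characters form an abelian group under pointwise multiplication (the character group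
of the idele class group).  Ref: Neukirch, *Algebraic Number Theory*, Ch. VII §6. [folklore] -/
instance instCommGroup : CommGroup (HeckeCharacter K) := (equivSubgroup K).commGroup

/-- The trivial Hecke character takes the value `1`. [folklore] -/
@[simp] theorem one_apply (x : ideleGroup K) : (1 : HeckeCharacter K) x = 1 := rfl

/-- Multiplication of Hecke characters is pointwise. [folklore] -/
@[simp] theorem mul_apply (χ ψ : HeckeCharacter K) (x : ideleGroup K) :
    (χ * ψ) x = χ x * ψ x := rfl

/-- Inversion of Hecke characters is pointwise. [folklore] -/
@[simp] theorem inv_apply (χ : HeckeCharacter K) (x : ideleGroup K) : χ⁻¹ x = (χ x)⁻¹ := rfl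

/-- Powers of Hecke characters are pointwise. [folklore] -/
@[simp] theorem pow_apply (χ : HeckeCharacter K) (n : ℕ) (x : ideleGroup K) :
    (χ ^ n) x = χ x ^ n :=
  ContinuousMonoidHom.pow_apply χ.toContinuousMonoidHom n x

end HeckeCharacter

/-! ### Infinite and finite components of ideles -/

/-- The inclusion of the **infinite ideles** `(K ⊗ ℝ)ˣ = (Π_{w ∣ ∞} K_w)ˣ ↪ 𝕀_K`
(`x ↦ (x, 1)`; `AdeleRing = InfiniteAdeleRing × FiniteAdeleRing`).
Ref: Neukirch, *Algebraic Number Theory*, Ch. VI §1. [folklore] -/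
def infiniteIdeles : (InfiniteAdeleRing K)ˣ →* ideleGroup K :=
  Units.map (MonoidHom.inl (InfiniteAdeleRing K) (FiniteAdeleRing (𝓞 K) K) :
    InfiniteAdeleRing K →* AdeleRing (𝓞 K) K)

variable {K}

section Single

open scoped RestrictedProduct
open scoped Classical

/-- The multiplicative map `K_v → 𝔸_{K,f}` placing `x` at `v` and `1` at every other finite
place (Mathlib `RestrictedProduct.mulSingle`; `FiniteAdeleRing (𝓞 K) K` is by definition the
restricted product `Πʳ v, [K_v, 𝒪_v]`).  Ref: Cassels–Fröhlich, Ch. II §14. [folklore] -/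
def finiteAdeleSingle (v : HeightOneSpectrum (𝓞 K)) :
    v.adicCompletion K →* FiniteAdeleRing (𝓞 K) K where
  toFun x := (RestrictedProduct.mulSingle
    (fun w : HeightOneSpectrum (𝓞 K) => w.adicCompletionIntegers K) v x :
      Πʳ w : HeightOneSpectrum (𝓞 K), [w.adicCompletion K, w.adicCompletionIntegers K])
  map_one' := RestrictedProduct.mulSingle_one _ _
  map_mul' := RestrictedProduct.mulSingle_mul _ _

/-- `finiteAdeleSingle v x` has component `x` at `v`. [folklore] -/
@[simp]
theorem finiteAdeleSingle_apply_self (v : HeightOneSpectrum (𝓞 K)) (x : v.adicCompletion K) :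
    finiteAdeleSingle v x v = x :=
  RestrictedProduct.mulSingle_eq_same (fun w : HeightOneSpectrum (𝓞 K) =>
    w.adicCompletionIntegers K) v x

/-- `finiteAdeleSingle v x` has component `1` away from `v`. [folklore] -/
theorem finiteAdeleSingle_apply_of_ne {v w : HeightOneSpectrum (𝓞 K)} (x : v.adicCompletion K)
    (h : w ≠ v) : finiteAdeleSingle v x w = 1 :=
  RestrictedProduct.mulSingle_eq_of_ne (fun w : HeightOneSpectrum (𝓞 K) =>
    w.adicCompletionIntegers K) x h

end Single

/-- The **local units embedding** `K_vˣ → 𝕀_K` at the finite place `v`: `u ↦` the idele which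
is `u` at `v` and `1` at every other (finite or infinite) place.
Ref: Neukirch, *Algebraic Number Theory*, Ch. VI §1; Tate (1950), §3.2.
[cite: TateThesis1967, §3.2] -/
def localUnits (v : HeightOneSpectrum (𝓞 K)) : (v.adicCompletion K)ˣ →* ideleGroup K :=
  Units.map ((MonoidHom.inr (InfiniteAdeleRing K) (FiniteAdeleRing (𝓞 K) K) :
    FiniteAdeleRing (𝓞 K) K →* AdeleRing (𝓞 K) K).comp (finiteAdeleSingle v))

/-- `localUnits v u` is `1` at the infinite places. [folklore] -/
@[simp]
theorem localUnits_fst (v : HeightOneSpectrum (𝓞 K)) (u : (v.adicCompletion K)ˣ) :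
    (localUnits v u : AdeleRing (𝓞 K) K).1 = 1 := rfl

/-- `localUnits v u` is `u` at `v`. [folklore] -/
@[simp]
theorem localUnits_snd_apply_self (v : HeightOneSpectrum (𝓞 K)) (u : (v.adicCompletion K)ˣ) :
    (localUnits v u : AdeleRing (𝓞 K) K).2 v = u :=
  finiteAdeleSingle_apply_self v _

/-- The **idele norm** `‖x‖ = ∏_{w ∣ ∞} ‖x_w‖^{[K_w:ℝ]} · ∏_{v ∤ ∞} ‖x_v‖_v` (normalised absolute
values; Mathlib's norms on `w.Completion` and on `v.adicCompletion K`, the latter with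
`‖ϖ_v‖ = N v⁻¹`).  The finite part is a `finprod` (all but finitely many factors are `1`).
Ref: Neukirch, *Algebraic Number Theory*, Ch. VI §1, before Prop. (1.3); Tate (1950), §4.3.
[cite: TateThesis1967, §4.3] -/
def ideleNorm (x : ideleGroup K) : ℝ :=
  (∏ w : InfinitePlace K, ‖(x : AdeleRing (𝓞 K) K).1 w‖ ^ w.mult) *
    ∏ᶠ v : HeightOneSpectrum (𝓞 K), ‖(x : AdeleRing (𝓞 K) K).2 v‖

/-- **Product formula**: principal ideles have idele norm `1`; proved from Mathlib
`NumberField.prod_abs_eq_one` (same argument as `Literature.NumberTheory.Automorphic.ideleNorm_principal` in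
`Literature/NumberTheory/Automorphic/IdeleClassGroup`, which is the `ℝ≥0`-valued twin).
Ref: Neukirch, *Algebraic Number Theory*, Ch. III §1, Prop. (1.3) and Ch. VI §1, Prop. (1.3);
Tate (1950), §4.3 (product formula). [folklore] -/
theorem ideleNorm_eq_one_of_mem_principalIdeles {x : ideleGroup K} (hx : x ∈ principalIdeles K) :
    ideleNorm x = 1 := by
  obtain ⟨u, rfl⟩ := hx
  have h := NumberField.prod_abs_eq_one (K := K) u.ne_zero
  rw [← finprod_comp_equiv FinitePlace.equivHeightOneSpectrum.symm] at h
  simp only [ideleNorm]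
  convert h using 2
  · refine Finset.prod_congr rfl fun w _ => ?_
    congr 1
    change ‖((u : K) : w.Completion)‖ = w u
    simpa using InfinitePlace.Completion.norm_coe (v := w) ((WithAbs.equiv w.1).symm u)
  · refine finprod_congr fun v => ?_
    rw [FinitePlace.equivHeightOneSpectrum_symm_apply]
    rfl

/-! ### Local components, ramification, values at uniformizers -/

namespace HeckeCharacter

variable (χ : HeckeCharacter K) (v : HeightOneSpectrum (𝓞 K))

/-- The **local component** `χ_v : K_vˣ → ℂˣ` of `χ` at the finite place `v`
(`χ_v = χ ∘ localUnits v`).  Ref: Tate (1950), §4.3 (with §3.2, local components of a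
quasi-character of a restricted direct product); Neukirch, Ch. VII §6, (6.10).
[cite: TateThesis1967, §4.3] -/
def localComponent : (v.adicCompletion K)ˣ →* ℂˣ :=
  χ.toContinuousMonoidHom.toMonoidHom.comp (localUnits v)

/-- Unfolding `localComponent`. [folklore] -/
@[simp]
theorem localComponent_apply (u : (v.adicCompletion K)ˣ) :
    χ.localComponent v u = χ (localUnits v u) := rfl

/-- `χ` is **unramified at** the finite place `v`: `χ_v` is trivial on the local units `𝒪_vˣ`.
Ref: Neukirch, *Algebraic Number Theory*, Ch. VII §6, (6.10)–(6.11); Tate (1950), §2.3.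
[cite: TateThesis1967, §2.3] -/
def IsUnramifiedAt (χ : HeckeCharacter K) (v : HeightOneSpectrum (𝓞 K)) : Prop :=
  ∀ u : (v.adicCompletionIntegers K)ˣ,
    χ.localComponent v (Units.map ((v.adicCompletionIntegers K).subtype : _ →* _) u) = 1

/-- The set of finite places where `χ` is ramified (the support of the finite part of the
conductor).  Ref: Neukirch, *Algebraic Number Theory*, Ch. VII §6, (6.11). [folklore] -/
def ramifiedPlaces : Set (HeightOneSpectrum (𝓞 K)) := {v | ¬χ.IsUnramifiedAt v}

/-- A Hecke character is **unramified at all but finitely many places** (continuity of `χ` and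
openness of `∏_v 𝒪_vˣ` in the finite ideles).
Ref: Tate (1950), Lemma 3.2.1 (a quasi-character of a restricted direct product is trivial on
all but finitely many `𝒪_vˣ`), applied to `𝕀_K` in §4.3; Neukirch, *Algebraic Number Theory*,
Ch. VII §6, proof of Prop. (6.12). [cite: TateThesis1967, Lemma 3.2.1] -/
def isUnramifiedAt_cofinite : Prop :=
  ∀ᶠ v in Filter.cofinite, χ.IsUnramifiedAt v

/-- Equivalently, `χ.ramifiedPlaces` is finite (Tate (1950), Lemma 3.2.1 applied in §4.3;
Neukirch, Ch. VII §6, proof of Prop. (6.12)); definitionally the same statement as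
`isUnramifiedAt_cofinite` (`finite_ramifiedPlaces_iff`). [cite: TateThesis1967, Lemma 3.2.1] -/
def finite_ramifiedPlaces : Prop :=
  χ.ramifiedPlaces.Finite

/-- `finite_ramifiedPlaces χ ↔ isUnramifiedAt_cofinite χ`: `∀ᶠ v in cofinite, P v` unfolds to
`{v | ¬ P v}.Finite` (Mathlib `Filter.eventually_cofinite`). [folklore] -/
theorem finite_ramifiedPlaces_iff : χ.finite_ramifiedPlaces ↔ χ.isUnramifiedAt_cofinite :=
  Filter.eventually_cofinite.symm

/-- The named fact `isUnramifiedAt_cofinite` yields `finite_ramifiedPlaces` (the interim proof,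
threaded). [folklore] -/
theorem finite_ramifiedPlaces_of_isUnramifiedAt_cofinite (h : χ.isUnramifiedAt_cofinite) :
    χ.finite_ramifiedPlaces :=
  χ.finite_ramifiedPlaces_iff.mpr h

variable (K) in
/-- The valuation in `K_v` of Mathlib's chosen `π ∈ K` with `v(π) = 1`
(`HeightOneSpectrum.valuation_exists_uniformizer`) is `exp (-1)`. [folklore] -/
theorem valued_coe_choose_uniformizer :
    Valued.v (((v.valuation_exists_uniformizer K).choose : K) : v.adicCompletion K) =
      WithZero.exp (-1 : ℤ) := by
  rw [HeightOneSpectrum.adicCompletion.valued_coe]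
  exact (v.valuation_exists_uniformizer K).choose_spec

variable (K) in
/-- A chosen **uniformizer** `ϖ_v ∈ K_vˣ`: the image in `K_v` of Mathlib's chosen `π ∈ K` with
`v(π) = 1` (`HeightOneSpectrum.valuation_exists_uniformizer`), a unit of the field `K_v`.
Ref: Neukirch, *Algebraic Number Theory*, Ch. II §3. [folklore] -/
def uniformizer : (v.adicCompletion K)ˣ :=
  Units.mk0 (((v.valuation_exists_uniformizer K).choose : K) : v.adicCompletion K) fun h => by
    have := valued_coe_choose_uniformizer K v
    rw [h, map_zero] at this
    exact WithZero.exp_ne_zero this.symm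

/-- The chosen uniformizer has valuation `exp (-1)` (i.e. normalised valuation `1`). [folklore] -/
theorem valued_uniformizer :
    Valued.v (uniformizer K v : v.adicCompletion K) = WithZero.exp (-1 : ℤ) :=
  valued_coe_choose_uniformizer K v

/-- The **value of `χ` at (a uniformizer of) `v`**, `χ(ϖ_v) ∈ ℂ` — the number classically written
`χ(𝔭_v)`; it is independent of the uniformizer when `χ` is unramified at `v`
(`localComponent_eq_valueAtUniformizer`).  Ref: Neukirch, Ch. VII §6, (6.12); Tate (1950), §2.5.
[cite: TateThesis1967, §2.5] -/
def valueAtUniformizer : ℂ := (χ.localComponent v (uniformizer K v) : ℂ)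

variable {χ v} in
/-- Independence of the uniformizer: if `χ` is unramified at `v` then `χ_v(ϖ) = χ(ϖ_v)` for
every `ϖ ∈ K_v` of valuation `1` (two uniformizers differ by a unit of `𝒪_v`).
Ref: Tate (1950), §2.5. [cite: TateThesis1967, §2.5] -/
theorem localComponent_eq_valueAtUniformizer (h : χ.IsUnramifiedAt v)
    {ϖ : (v.adicCompletion K)ˣ}
    (hϖ : Valued.v (ϖ : v.adicCompletion K) = WithZero.exp (-1 : ℤ)) :
    (χ.localComponent v ϖ : ℂ) = χ.valueAtUniformizer v := by
  set π := uniformizer K v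
  set w : (v.adicCompletion K)ˣ := ϖ * π⁻¹ with hw
  have hu : Valued.v (w : v.adicCompletion K) = 1 := by
    rw [hw, Units.val_mul, map_mul, Units.val_inv_eq_inv_val, map_inv₀, hϖ, valued_uniformizer,
      mul_inv_cancel₀ WithZero.exp_ne_zero]
  have hu' : Valued.v ((w⁻¹ : (v.adicCompletion K)ˣ) : v.adicCompletion K) = 1 := by
    rw [Units.val_inv_eq_inv_val, map_inv₀, hu, inv_one]
  let u : (v.adicCompletionIntegers K)ˣ :=
    ⟨⟨(w : v.adicCompletion K), hu.le⟩, ⟨((w⁻¹ : (v.adicCompletion K)ˣ) : v.adicCompletion K),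
      hu'.le⟩, Subtype.ext w.mul_inv, Subtype.ext w.inv_mul⟩
  have hmap : Units.map ((v.adicCompletionIntegers K).subtype : _ →* _) u = w :=
    Units.ext rfl
  have := h u
  rw [hmap, map_mul, map_inv, mul_inv_eq_one] at this
  rw [this]
  rfl

/-! ### Global predicates -/

/-- `χ` is **unitary** (a character in the strict sense): `|χ(x)| = 1` for all ideles `x`.
Ref: Tate (1950), §2.3 ("character" = quasi-character of absolute value `1`), used globally in
§4.3. [cite: TateThesis1967, §2.3] -/
def IsUnitary (χ : HeckeCharacter K) : Prop := ∀ x : ideleGroup K, ‖(χ x : ℂ)‖ = 1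

/-- `χ` has **finite order** in the group of Hecke characters (equivalently, factors through a
finite quotient of the idele class group, i.e. comes from a ray class character).
Ref: Neukirch, *Algebraic Number Theory*, Ch. VII §6, (6.9). [folklore] -/
def IsFiniteOrder (χ : HeckeCharacter K) : Prop := IsOfFinOrder χ

/-- `χ` is a **norm twist** `‖·‖^z` for some `z ∈ ℂ` (the characters whose L-function is a
translate of `ζ_K`, hence has a pole).  Ref: Tate (1950), §4.4, Thm 4.4.1 (the "trivial on
`𝕀_K¹`" case); Neukirch, Ch. VII §8, Cor. (8.6). [cite: TateThesis1967, Thm. 4.4.1] -/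
def IsNormTwist (χ : HeckeCharacter K) : Prop :=
  ∃ z : ℂ, ∀ x : ideleGroup K, (χ x : ℂ) = (ideleNorm x : ℂ) ^ z

/-- `χ` is **algebraic** (of type `A₀` in Weil's sense): there are integers `p_w, q_w` such that
on some neighbourhood `U` of `1` in the infinite ideles `(K ⊗ ℝ)ˣ`,
`χ(x) = ∏_{w ∣ ∞} ι_w(x_w)^{-p_w} · conj(ι_w(x_w))^{-q_w}`, where `ι_w : K_w → ℂ` is Mathlib's
`InfinitePlace.Completion.extensionEmbedding w` (for real `w` only `p_w + q_w` matters).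
Ref: A. Weil, *On a certain type of characters of the idèle-class group* (1956), §1;
Serre, *Abelian ℓ-adic representations* (1968), Ch. II §2.4 (via algebraic homomorphisms).
[folklore] -/
def IsAlgebraic (χ : HeckeCharacter K) : Prop :=
  ∃ p q : InfinitePlace K → ℤ, ∃ U ∈ nhds (1 : (InfiniteAdeleRing K)ˣ), ∀ x ∈ U,
    (χ (infiniteIdeles K x) : ℂ) =
      ∏ w : InfinitePlace K,
        InfinitePlace.Completion.extensionEmbedding w ((x : InfiniteAdeleRing K) w) ^ (-p w) *
          (starRingEnd ℂ)
            (InfinitePlace.Completion.extensionEmbedding w ((x : InfiniteAdeleRing K) w)) ^ (-q w)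

/-- Norm twists are unramified everywhere (the idele norm is trivial on `𝒪_vˣ`).
Ref: Tate (1950), §2.3. [cite: TateThesis1967, §2.3] -/
def IsNormTwist.isUnramifiedAt : Prop :=
  ∀ {χ : HeckeCharacter K} (_h : χ.IsNormTwist) (v : HeightOneSpectrum (𝓞 K)),
    χ.IsUnramifiedAt v

/-- Finite-order characters are unitary (their values are roots of unity). [folklore] -/
theorem IsFiniteOrder.isUnitary {χ : HeckeCharacter K} (h : χ.IsFiniteOrder) : χ.IsUnitary := by
  obtain ⟨n, hn, h1⟩ := h.exists_pow_eq_one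
  intro x
  have hx : ((χ ^ n) x : ℂ) = 1 := by rw [h1, one_apply, Units.val_one]
  rw [pow_apply, Units.val_pow_eq_pow_val] at hx
  exact Complex.norm_eq_one_of_pow_eq_one hx hn.ne'

end HeckeCharacter

/-! ### Hecke L-functions -/

section LFunction

variable (χ : HeckeCharacter K)

/-- The **Hecke L-function** `L(χ, s) = ∏_{v ∤ 𝔣(χ)} (1 - χ(ϖ_v) N v^{-s})⁻¹`, as an
unconditional product (`tprod`) over the finite places at which `χ` is unramified
(`N v = v.residueCard`).  This is the genuine value where the Euler product converges
(`re s > 1` for unitary `χ`, `multipliable_heckeLFunction`) and the junk value of `tprod`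
elsewhere; continuation is expressed via `LFunction.HasMeromorphicContinuation`.
Ref: Hecke (1920); Tate (1950), §4.4; Neukirch, *Algebraic Number Theory*, Ch. VII §8,
Def. (8.1) with Prop. (6.12). [cite: HeckeMathZ1920, §1] -/
def heckeLFunction (s : ℂ) : ℂ :=
  ∏' v : {v : HeightOneSpectrum (𝓞 K) // χ.IsUnramifiedAt v},
    (1 - χ.valueAtUniformizer v.1 * ((v.1.residueCard : ℂ) ^ (-s)))⁻¹

/-- For unitary `χ` the Euler product converges on `re s > 1`.  The printed proposition
(Neukirch, Ch. VII §8, Prop. (8.1)) asserts absolute and locally uniform convergence on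
`re s ≥ 1 + δ`; the formal statement is only its corollary that the product is `Multipliable`
(unconditional convergence of the finite partial products, Mathlib), which is what makes
`heckeLFunction χ s` the genuine value there.
Ref: Neukirch, *Algebraic Number Theory*, Ch. VII §8, Prop. (8.1).
[cite: NeukirchANT1999, Ch. VII Prop. (8.1)] -/
def multipliable_heckeLFunction : Prop :=
  ∀ (_hχ : χ.IsUnitary) {s : ℂ} (_hs : 1 < s.re),
    Multipliable fun v : {v : HeightOneSpectrum (𝓞 K) // χ.IsUnramifiedAt v} =>
      (1 - χ.valueAtUniformizer v.1 * ((v.1.residueCard : ℂ) ^ (-s)))⁻¹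

/-- An **archimedean `Γ`-factor of Hecke type** with shifts `a : (w ∣ ∞) → ℂ`:
`γ_a(s) = ∏_{w real} Γ_ℝ(s + a_w) · ∏_{w complex} Γ_ℂ(s + a_w)` (Mathlib `Complex.Gammaℝ`,
`Complex.Gammaℂ`).  For a unitary `χ` with `χ_w(x) = sgn(x)^δ |x|^{iφ}` (real `w`) resp.
`χ_w(z) = (z/|z|)^k |z|^{2iφ}` (complex `w`) the shifts are `δ + iφ` resp. `|k|/2 + iφ`.
Ref: Tate (1950), §2.5 (local factors at archimedean places); Neukirch, Ch. VII §8, (8.3).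
[cite: TateThesis1967, §2.5] -/
def HeckeCharacter.archGammaFactor (a : InfinitePlace K → ℂ) (s : ℂ) : ℂ :=
  open scoped Classical in
  ∏ w : InfinitePlace K, if w.IsReal then Complex.Gammaℝ (s + a w) else Complex.Gammaℂ (s + a w)

/-- **Meromorphic continuation** (Hecke 1920; Tate 1950): the L-function of a unitary Hecke
character extends meromorphically to `ℂ` (with at most simple poles, occurring only for norm
twists).  Ref: Tate (1950), Thm 4.4.1; Neukirch, *Algebraic Number Theory*, Ch. VII §8,
Thm (8.5). [cite: TateThesis1967, Thm. 4.4.1] -/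
def heckeLFunction_hasMeromorphicContinuation : Prop :=
  ∀ (_hχ : χ.IsUnitary),
    LFunction.HasMeromorphicContinuation (heckeLFunction χ)

/-- **Entire continuation** for characters which are not norm twists `‖·‖^{it}`: then `L(χ, s)`
extends to an entire function.  Ref: Tate (1950), Thm 4.4.1; Neukirch, *Algebraic Number
Theory*, Ch. VII §8, Cor. (8.6). [cite: TateThesis1967, Thm. 4.4.1] -/
def heckeLFunction_hasEntireContinuation_of_not_isNormTwist : Prop :=
  ∀ (_hχ : χ.IsUnitary) (_h : ¬χ.IsNormTwist),
    LFunction.HasEntireContinuation (heckeLFunction χ)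

/-- **Functional equation** (Hecke 1920; Tate 1950) for a unitary Hecke character `χ`: there
are a conductor-discriminant constant `A > 0`, archimedean shifts `a, a'` and a root number `W`
with `|W| = 1`, and meromorphic `Λ, Λ'` on `ℂ` with `Λ(s) = A^{s/2} γ_a(s) L(χ, s)` and
`Λ'(s) = A^{s/2} γ_{a'}(s) L(χ⁻¹, s)` for `re s > 1`, such that `Λ(1 - s) = W Λ'(s)`
(`χ⁻¹ = χ̄` for unitary `χ`).
Ref: Tate (1950), Thm 4.4.1 and §4.5; Neukirch, *Algebraic Number Theory*, Ch. VII §8,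
Thm (8.5); Hecke, Math. Z. 6 (1920). [cite: TateThesis1967, Thm. 4.4.1] -/
def heckeLFunction_functional_equation : Prop :=
  ∀ (_hχ : χ.IsUnitary),
    ∃ (A : ℝ) (a a' : InfinitePlace K → ℂ) (W : ℂ) (Λ Λ' : ℂ → ℂ), 0 < A ∧ ‖W‖ = 1 ∧
      Meromorphic Λ ∧ Meromorphic Λ' ∧
      (∀ s : ℂ, 1 < s.re →
        Λ s = (A : ℂ) ^ (s / 2) * HeckeCharacter.archGammaFactor a s * heckeLFunction χ s ∧
        Λ' s = (A : ℂ) ^ (s / 2) * HeckeCharacter.archGammaFactor a' s *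
          heckeLFunction χ⁻¹ s) ∧
      ∀ s : ℂ, Λ (1 - s) = W * Λ' s

end LFunction

/-! ### `K = ℚ`: Dirichlet characters -/

section Rat

/-- **Hecke characters of `ℚ` of finite order come from Dirichlet characters**: for every
Dirichlet character `χ` mod `m` there is a unique finite-order Hecke character `ψ` of `ℚ` such
that at every prime `p ∤ m` (i.e. `v` with `m ∉ v`), `ψ` is unramified and
`ψ(ϖ_p) = χ(p)` (`p = N v = v.residueCard`); in particular `L(ψ, s) = L(χ₀, s)` for the
primitive character `χ₀` inducing `χ`.
Ref: Neukirch, *Algebraic Number Theory*, Ch. VII §6, Prop. (6.9) and example after (6.12);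
Tate (1950), §2.3; Washington, *Introduction to Cyclotomic Fields*, Ch. 3.
[cite: NeukirchANT1999, Ch. VII Prop. (6.9)] -/
def HeckeCharacter.exists_of_dirichletCharacter : Prop :=
  ∀ {m : ℕ} [NeZero m] (χ : DirichletCharacter ℂ m),
    ∃! ψ : HeckeCharacter ℚ, ψ.IsFiniteOrder ∧
      ∀ v : HeightOneSpectrum (𝓞 ℚ), (m : 𝓞 ℚ) ∉ v.asIdeal →
        ψ.IsUnramifiedAt v ∧ ψ.valueAtUniformizer v = χ (v.residueCard : ZMod m)

/-- Conversely, every finite-order Hecke character of `ℚ` arises from a Dirichlet character in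
this way (Kronecker–Weber / `𝕀_ℚ / ℚˣ ℝ_{>0} ≅ ẑˣ`).
Ref: Neukirch, *Algebraic Number Theory*, Ch. VII §6, Prop. (6.9); Ch. VI §1, Ex. 2.
[cite: NeukirchANT1999, Ch. VII Prop. (6.9)] -/
def HeckeCharacter.exists_dirichletCharacter_of_isFiniteOrder : Prop :=
  ∀ (ψ : HeckeCharacter ℚ) (_hψ : ψ.IsFiniteOrder),
    ∃ (m : ℕ) (_ : NeZero m) (χ : DirichletCharacter ℂ m),
      ∀ v : HeightOneSpectrum (𝓞 ℚ), (m : 𝓞 ℚ) ∉ v.asIdeal →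
        ψ.IsUnramifiedAt v ∧ ψ.valueAtUniformizer v = χ (v.residueCard : ZMod m)

end Rat

end Literature.NumberTheory.GaloisRepresentations
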